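import Mathlib
import HarnessLib
import Summits.NavierStokesRegularity.NavierStokesRegularity.Theorems.ThreadingFluxHorizonTowerFiniteTowerToolkit
import Summits.NavierStokesRegularity.NavierStokesRegularity.Theorems.ThreadingFluxHorizonTowerProfileFormulas
import Summits.NavierStokesRegularity.NavierStokesRegularity.Theorems.UnthreadedDoorKinematicShadowPointSourceCalculus

/-!
# Crux `PoloidalLiouville` (stmt-NavierStokesRegularity-1222, wall W1), crux idea «horizon-threading-tower» (ns-idea-15):
# DIPOLE TOWERS `{1, m, n}` AT ORDER ONE — the dipole shell and radial weights in the bracket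

ARM A (ns-exp-scalarLiouville g5), director KEY 2026-08-29T04:32:46Z (β), helper 2 (bottom-up; route ns-wall-eng-3 g3 TwoShellTowers-RESULTS §4b).
The remaining (third-shell) step of «dipole towers decided at order one» multiplies the two-term parity class by `|a × x|²` and rewrites
both brackets as multiples of the rotational derivative `⟪x, ∇B × a⟫` (eng-3's `bracket_with_zonal`).  This file supplies the two
elementary inputs of that rewriting:
* the DIPOLE: a differentiable `A` with `A(c y) = c A(y)` for all real `c` is linear (`dipole_eq_fderiv_apply`), its gradient is a
  constant vector (`dipole_gradient_eq`), and if `A` is zonal about `a ≠ 0` in rotational form (`⟪a × x, ∇A⟫ ≡ 0`) that vector is a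
  multiple of `a` (`exists_smul_of_inner_cross_eq_zero`, `dipole_gradient_eq_smul_axis`); its zonal multiplier is
  `‖x‖²⟪∇A, a⟫ − ⟪a, x⟫⟪∇A, x⟫ = κ |a × x|²` (`dipole_zonalMultiplier`);
* RADIAL WEIGHTS pass through the bracket: `⟪x, ∇(g(‖·‖²) F) × ∇G⟫ = g(‖x‖²) ⟪x, ∇F × ∇G⟫` (`bracket_radialWeight_left`) — so the
  weighted class identities of `dipoleTower_pair_identities` are brackets of `B` with ONE zonal (non-harmonic) function.

HONEST LABEL: helper lemmas toward a special case of a crux-idea conjecture; `HorizonTowerZonality`, `PoloidalLiouville` (1222) and NS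
regularity are OPEN / NOT proved; nothing here is an NS statement.  `--supports stmt-NavierStokesRegularity-1222 --as helper`.
-/

-- the summit and its single sub-problem share the name (CONVENTIONS §1)
set_option linter.dupNamespace false

noncomputable section

namespace Summit.NavierStokesRegularity.NavierStokesRegularity.Theorems.PoloidalLiouville.HorizonTower

open Set Function Filter Topology InnerProductSpace
open scoped RealInnerProductSpace
open Literature.Analysis.FluidPDE
open Literature.Geometry.DiscreteGeometry (inner_fin3 norm_sq_fin3)

section Dipole

variable {A : E3 → ℝ}

/-- **A real-homogeneous function of degree one is linear**: `A y = DA(0) y`. [folklore] -/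
theorem dipole_eq_fderiv_apply (hA : Differentiable ℝ A) (hhom : ∀ (c : ℝ) (y : E3), A (c • y) = c ^ 1 * A y) (y : E3) :
    A y = fderiv ℝ A 0 y := by
  -- `t ↦ A (t y) = t A y`; differentiate at `t = 0`
  have h1 : HasDerivAt (fun t : ℝ => A (t • y)) (fderiv ℝ A ((0 : ℝ) • y) y) 0 := by
    have hl : HasDerivAt (fun t : ℝ => t • y) y 0 := by simpa using (hasDerivAt_id (0 : ℝ)).smul_const y
    exact (hA _).hasFDerivAt.comp_hasDerivAt (0 : ℝ) hl
  have h2 : HasDerivAt (fun t : ℝ => A (t • y)) (A y) 0 := by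
    have heq : (fun t : ℝ => A (t • y)) = fun t => t * A y := funext fun t => by rw [hhom, pow_one]
    rw [heq]
    simpa using (hasDerivAt_id (0 : ℝ)).mul_const (A y)
  rw [zero_smul] at h1
  exact h2.unique h1

/-- **The gradient of a dipole is a constant vector**: `∇A(x) = ∇A(0)` for all `x`. [folklore] -/
theorem dipole_gradient_eq (hA : Differentiable ℝ A) (hhom : ∀ (c : ℝ) (y : E3), A (c • y) = c ^ 1 * A y) (x : E3) :
    gradient A x = gradient A 0 := by
  set L : E3 →L[ℝ] ℝ := fderiv ℝ A 0 with hL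
  have hfun : A = ⇑L := funext fun y => by rw [hL]; exact dipole_eq_fderiv_apply hA hhom y
  have hD : ∀ z : E3, fderiv ℝ A z = L := fun z => by rw [hfun]; exact L.fderiv
  unfold gradient
  rw [hD x, hD 0]

/-- If `⟪a × x, b⟫ = 0` for every `x` and `a ≠ 0`, then `b` is a multiple of `a`. [folklore] -/
theorem exists_smul_of_inner_cross_eq_zero {a b : E3} (ha : a ≠ 0) (h : ∀ x : E3, ⟪cross a x, b⟫ = 0) :
    ∃ κ : ℝ, b = κ • a := by
  -- `b × a = 0`
  have htrip : ∀ x : E3, ⟪cross a x, b⟫ = ⟪x, cross b a⟫ := fun x => by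
    obtain ⟨p0, p1, p2⟩ := cross_fin3 a x
    obtain ⟨q0, q1, q2⟩ := cross_fin3 b a
    rw [inner_fin3, inner_fin3, p0, p1, p2, q0, q1, q2]; ring
  have hc : cross b a = 0 := by
    have := h (cross b a)
    rw [htrip, real_inner_self_eq_norm_sq] at this
    exact norm_eq_zero.1 (pow_eq_zero_iff two_ne_zero |>.1 this)
  -- Lagrange: `‖b × a‖² = ‖b‖²‖a‖² − ⟪b,a⟫²`
  have hL := Zonal.norm_cross_sq b a
  rw [hc, norm_zero] at hL
  have ha2 : 0 < ‖a‖ ^ 2 := by positivity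
  refine ⟨⟪b, a⟫ / ‖a‖ ^ 2, ?_⟩
  have hzero : ‖b - (⟪b, a⟫ / ‖a‖ ^ 2) • a‖ ^ 2 = 0 := by
    rw [norm_sub_sq_real, norm_smul, real_inner_smul_right, Real.norm_eq_abs, mul_pow, sq_abs]
    field_simp
    nlinarith [hL]
  have := norm_eq_zero.1 (pow_eq_zero_iff two_ne_zero |>.1 hzero)
  exact (sub_eq_zero.1 this)

/-- ★ **A dipole zonal about `a` has gradient `κ a`**: `A` differentiable, real-homogeneous of degree one, `⟪a × x, ∇A(x)⟫ = 0` for all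
`x`, `a ≠ 0` ⇒ `∃ κ, ∀ x, ∇A(x) = κ a`. [folklore] -/
theorem dipole_gradient_eq_smul_axis (hA : Differentiable ℝ A) (hhom : ∀ (c : ℝ) (y : E3), A (c • y) = c ^ 1 * A y) {a : E3}
    (ha : a ≠ 0) (hzon : ∀ x : E3, ⟪cross a x, gradient A x⟫ = 0) :
    ∃ κ : ℝ, ∀ x : E3, gradient A x = κ • a := by
  obtain ⟨κ, hκ⟩ := exists_smul_of_inner_cross_eq_zero ha (b := gradient A 0)
    (fun x => by rw [← dipole_gradient_eq hA hhom x]; exact hzon x)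
  exact ⟨κ, fun x => by rw [dipole_gradient_eq hA hhom x, hκ]⟩

/-- The zonal multiplier of a dipole: with `∇A ≡ κ a`, `‖x‖²⟪∇A(x), a⟫ − ⟪a, x⟫⟪∇A(x), x⟫ = κ |a × x|²`. [folklore] -/
theorem dipole_zonalMultiplier {a : E3} {κ : ℝ} {x : E3} (hg : gradient A x = κ • a) :
    ‖x‖ ^ 2 * ⟪gradient A x, a⟫ - ⟪a, x⟫ * ⟪gradient A x, x⟫ = κ * ‖cross a x‖ ^ 2 := by
  rw [hg, Zonal.norm_cross_sq, real_inner_smul_left, real_inner_smul_left, real_inner_self_eq_norm_sq]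
  ring

end Dipole

section RadialWeight

/-- ★ **Radial weights pass through the bracket**: `⟪x, ∇(g(‖·‖²)·F)(x) × ∇G(x)⟫ = g(‖x‖²) ⟪x, ∇F(x) × ∇G(x)⟫` (the extra term is
`F(x)·2g′ ⟪x, x × ∇G⟫ = 0`). [folklore] -/
theorem bracket_radialWeight_left {g : ℝ → ℝ} {g₁ : ℝ} {F G : E3 → ℝ} {x : E3} (hg : HasDerivAt g g₁ (‖x‖ ^ 2))
    (hF : DifferentiableAt ℝ F x) :
    ⟪x, cross (gradient (fun y : E3 => g (‖y‖ ^ 2) * F y) x) (gradient G x)⟫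
      = g (‖x‖ ^ 2) * ⟪x, cross (gradient F x) (gradient G x)⟫ := by
  have hgd : DifferentiableAt ℝ (fun y : E3 => g (‖y‖ ^ 2)) x :=
    hg.differentiableAt.comp x (differentiableAt_id.norm_sq ℝ)
  rw [gradient_mul_apply hgd hF, gradient_comp_norm_sq hg]
  -- left-linearity of the cross product (via the right-linear `PointSource` lemmas and anticommutativity)
  have hadd : ∀ u v w : E3, cross (u + v) w = cross u w + cross v w := fun u v w => by
    rw [KinematicShadow.PointSource.cross_anticomm, KinematicShadow.PointSource.cross_add_right, neg_add,
      ← KinematicShadow.PointSource.cross_anticomm, ← KinematicShadow.PointSource.cross_anticomm]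
  have hsmul : ∀ (c : ℝ) (u w : E3), cross (c • u) w = c • cross u w := fun c u w => by
    rw [KinematicShadow.PointSource.cross_anticomm, KinematicShadow.PointSource.cross_smul_right, ← smul_neg,
      ← KinematicShadow.PointSource.cross_anticomm]
  have hself : ⟪x, cross x (gradient G x)⟫ = 0 := by
    rw [real_inner_comm]; exact Zonal.inner_cross_self_left x (gradient G x)
  rw [hadd, hsmul, hsmul, hsmul, inner_add_right, real_inner_smul_right, real_inner_smul_right, real_inner_smul_right, hself,
    mul_zero, mul_zero, add_zero]

/-- The same with the weight written as a real power of `‖x‖²` (the weights of `dipoleTower_pair_identities`), `x ≠ 0`. [folklore] -/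
theorem bracket_rpowWeight_left {e : ℝ} {F G : E3 → ℝ} {x : E3} (hx : x ≠ 0) (hF : DifferentiableAt ℝ F x) :
    ⟪x, cross (gradient (fun y : E3 => (‖y‖ ^ 2) ^ e * F y) x) (gradient G x)⟫
      = (‖x‖ ^ 2) ^ e * ⟪x, cross (gradient F x) (gradient G x)⟫ := by
  have hr : 0 < ‖x‖ ^ 2 := by positivity
  exact bracket_radialWeight_left (g := fun s : ℝ => s ^ e) (F := F) (G := G) (Real.hasDerivAt_rpow_const (Or.inl hr.ne')) hF

end RadialWeight

end Summit.NavierStokesRegularity.NavierStokesRegularity.Theorems.PoloidalLiouville.HorizonTower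

end
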